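/-
Copyright (c) 2026. Released under Apache 2.0 license.
-/
import Literature.Combinatorics.Words.ThueMorseOverlapFree
import Mathlib.Data.List.PeriodicityLemma
import Mathlib.Data.Nat.Digits.Defs
import Literature.Combinatorics.Enumerative.ProuhetThueMorse
import HarnessLib

/-!
# The infinite word of Thue–Morse is overlap-free

Lothaire, *Combinatorics on Words* (1997), §2.2, continued from
`Words/ThueMorseOverlapFree.lean` (the morphism `μ`, the words `uₙ = μⁿ(a)` and their
overlap-freeness, Theorem 2.2.3 in finite form).  Here the infinite word

  `t = μ^ω(a) = lim uₙ = abbabaabbaababba⋯`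

is the function `thueMorseSeq : ℕ → Bool` (`tₙ` = the letter of index `n` of `uₙ`, `n < 2ⁿ`), and:

* `thueMorseWord_eq_map_range` — `uₙ = t₀ ⋯ t_{2ⁿ-1}`; `thueMorseSeq_two_mul`,
  `thueMorseSeq_two_mul_add_one` — `t_{2k} = t_k`, `t_{2k+1} = t̄_k`;
* `thueMorseSeq_eq_true_iff` — **Proposition 2.2.2**: `tₙ = b` iff the binary digit sum `d₂(n)`
  is odd;
* `hasOverlap_iff_exists_infix_hasPeriod` — Lemma 2.1.1 in window form: an overlapping factor
  `c v c v c` is the same as a factor of length `2p + 1` with period `p ≥ 1` (`List.HasPeriod`);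
* `exists_thueMorseSeq_ne`, `not_forall_thueMorseSeq_eq_add` — **Theorem 2.2.3** for `t`: no
  window `tᵢ ⋯ t_{i+2p}` (`p ≥ 1`) has period `p`; `not_forall_thueMorseSeq_eq_add_of_cube`,
  `thueMorseSeq_ne_or_ne` — Corollary 2.2.4: `t` is cube-free, in particular has no factor `ccc`.

All statements are Lean transcriptions of the cited text (the infinite word handled through its
left factors `uₙ`); no novelty is claimed.  Mathlib has `List.HasPeriod` (periodicity lemma) but
not the Thue–Morse word; the tree's `Literature/Combinatorics/Enumerative/ProuhetThueMorse.lean`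
has the sign cells `ε⁽ⁿ⁾_j = (−1)^{d₂(j)}` (bridged below by `mpSign_eq_ite_thueMorseSeq`) but not
the word, its factors or overlaps.  That `t` avoids overlaps is also certified mechanically by the
decision procedure for automatic sequences (H. Mousavi, *Automatic theorem proving in Walnut*,
arXiv:1603.06017, 2016: the predicate "`T` has an overlap `axaxa`" evaluates to the false
automaton); the present file is a conventional proof-assistant transcription of Lothaire's argument.

## References

* [Lothaire1997] M. Lothaire, *Combinatorics on Words*, Cambridge University Press (1997), §2.1
  Lemma 2.1.1, §2.2 Propositions 2.2.1–2.2.2, Theorem 2.2.3, Corollary 2.2.4.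
-/

namespace Literature.Combinatorics.Words

/-! ### Overlapping factors as periodic windows (Lemma 2.1.1) -/

/-- **Lemma 2.1.1 (Lothaire 1997), window form**: `w` has an overlapping factor `c v c v c` iff some
factor `u` of `w` of length `2p + 1` has the period `p ≥ 1` (`p = |cv|`; Mathlib's
`List.HasPeriod`). [cite: Lothaire1997, Lemma 2.1.1] -/
theorem hasOverlap_iff_exists_infix_hasPeriod {α : Type*} {w : List α} :
    HasOverlap w ↔
      ∃ (u : List α) (p : ℕ), u <:+: w ∧ 0 < p ∧ u.length = 2 * p + 1 ∧ u.HasPeriod p := by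
  constructor
  · rintro ⟨c, x, v, y, rfl⟩
    refine ⟨c :: (v ++ c :: (v ++ [c])), v.length + 1, ⟨x, y, by simp⟩, Nat.succ_pos _,
      by simp only [List.length_cons, List.length_append, List.length_nil]; omega, ?_⟩
    rw [List.HasPeriod, show (v.length + 1) = (c :: v).length by simp,
      show c :: (v ++ c :: (v ++ [c])) = (c :: v) ++ (c :: (v ++ [c])) by simp, List.take_left]
    exact ⟨v ++ [c], by simp⟩
  · rintro ⟨u, p, ⟨s, t, rfl⟩, hp, hlen, hper⟩
    -- `u = a b` with `|a| = p`, `|b| = p + 1`; the period gives `b ⊑ u = a b`, so `a ⊑ b`,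
    -- `b = a c`, and `[c] ⊑ a c` forces `a = c v`: `u = (c v) (c v) c`.
    obtain ⟨a, b, hu, ha⟩ : ∃ a b : List α, u = a ++ b ∧ a.length = p :=
      ⟨u.take p, u.drop p, (List.take_append_drop p u).symm, by simp [hlen]; omega⟩
    subst hu
    have hb : b.length = p + 1 := by
      simp only [List.length_append] at hlen; omega
    have hbu : b <+: a ++ b := by
      have h := hper.drop_prefix
      rwa [show List.drop p (a ++ b) = b by rw [← ha]; exact List.drop_left] at h
    have hab : a <+: b :=
      List.prefix_of_prefix_length_le (List.prefix_append a b) hbu (by omega)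
    obtain ⟨b', rfl⟩ := hab
    obtain ⟨c, rfl⟩ : ∃ c, b' = [c] := by
      have : b'.length = 1 := by simp only [List.length_append] at hb; omega
      exact List.length_eq_one_iff.1 this
    have hca : [c] <+: a ++ [c] := (List.prefix_append_right_inj a).1 hbu
    obtain ⟨d, v, rfl⟩ : ∃ d v, a = d :: v := by
      cases a with
      | nil => simp at ha; omega
      | cons d v => exact ⟨d, v, rfl⟩
    obtain rfl : c = d := by simpa using hca
    exact ⟨c, s, v, t, by simp⟩

/-! ### The infinite word `t = μ^ω(a)` -/

/-- The **Thue–Morse infinite word** `t = abbabaabbaababba⋯` as a function `ℕ → Bool`: `tₙ` is the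
letter of index `n` of `uₙ = μⁿ(a)` (well defined since `n < 2ⁿ = |uₙ|`, and every `uₘ`, `m ≥ n`,
starts with `uₙ`). [cite: Lothaire1997, §2.2 (t = μ^ω(a) = lim uₙ)] -/
def thueMorseSeq (n : ℕ) : Bool := (thueMorseWord n).getD n false

/-- `uₘ` is a left factor of `uₙ` for `m ≤ n`. [cite: Lothaire1997, §2.2 (Prop 2.2.1 (i))] -/
theorem thueMorseWord_prefix {m n : ℕ} (h : m ≤ n) : thueMorseWord m <+: thueMorseWord n := by
  induction h with
  | refl => exact List.prefix_rfl
  | step _ ih => exact ih.trans (by rw [thueMorseWord_succ]; exact List.prefix_append _ _)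

/-- The letter of index `k < 2ⁿ` of `uₙ` is `tₖ` (`t = lim uₙ`).
[cite: Lothaire1997, §2.2 (t = μ^ω(a))] -/
theorem getElem?_thueMorseWord {n k : ℕ} (hk : k < 2 ^ n) :
    (thueMorseWord n)[k]? = some (thueMorseSeq k) := by
  have hkk : k < (thueMorseWord k).length := by
    rw [length_thueMorseWord]; exact Nat.lt_two_pow_self
  have hkn : k < (thueMorseWord n).length := by rwa [length_thueMorseWord]
  -- `uₙ` and `uₖ` are prefix-comparable and both longer than `k`
  have key : (thueMorseWord n)[k]? = (thueMorseWord k)[k]? := by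
    rcases le_total k n with h | h
    · obtain ⟨s, hs⟩ := thueMorseWord_prefix h
      rw [← hs, List.getElem?_append_left hkk]
    · obtain ⟨s, hs⟩ := thueMorseWord_prefix h
      rw [← hs, List.getElem?_append_left hkn]
  rw [key, thueMorseSeq, List.getD_eq_getElem?_getD, List.getElem?_eq_getElem hkk]
  rfl

/-- `uₙ = t₀ t₁ ⋯ t_{2ⁿ-1}`: the words `uₙ` are the left factors of `t` of length `2ⁿ`.
[cite: Lothaire1997, §2.2 (t = μ^ω(a))] -/
theorem thueMorseWord_eq_map_range (n : ℕ) :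
    thueMorseWord n = (List.range (2 ^ n)).map thueMorseSeq := by
  apply List.ext_getElem?
  intro k
  by_cases hk : k < 2 ^ n
  · rw [getElem?_thueMorseWord hk, List.getElem?_map, List.getElem?_range hk]; rfl
  · rw [List.getElem?_eq_none (by rw [length_thueMorseWord]; omega),
      List.getElem?_eq_none (by simp; omega)]

/-- Letters of `μ(w)` at even positions: `μ(w)_{2k} = w_k`.
[cite: Lothaire1997, Prop 2.2.2 (proof)] -/
theorem getElem?_thueMorseMorphism_two_mul (w : List Bool) (k : ℕ) :
    (thueMorseMorphism w)[2 * k]? = w[k]? := by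
  induction w generalizing k with
  | nil => simp
  | cons c w ih =>
    cases k with
    | zero => simp
    | succ k =>
      rw [thueMorseMorphism_cons, show 2 * (k + 1) = 2 * k + 1 + 1 by ring,
        List.getElem?_cons_succ, List.getElem?_cons_succ, ih, List.getElem?_cons_succ]

/-- Letters of `μ(w)` at odd positions: `μ(w)_{2k+1} = w̄_k`.
[cite: Lothaire1997, Prop 2.2.2 (proof)] -/
theorem getElem?_thueMorseMorphism_two_mul_add_one (w : List Bool) (k : ℕ) :
    (thueMorseMorphism w)[2 * k + 1]? = (w[k]?).map (! ·) := by
  induction w generalizing k with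
  | nil => simp
  | cons c w ih =>
    cases k with
    | zero => simp
    | succ k =>
      rw [thueMorseMorphism_cons, show 2 * (k + 1) + 1 = 2 * k + 1 + 1 + 1 by ring,
        List.getElem?_cons_succ, List.getElem?_cons_succ, ih, List.getElem?_cons_succ]

/-- `t₀ = a`. [cite: Lothaire1997, §2.2 (t starts with a)] -/
@[simp] theorem thueMorseSeq_zero : thueMorseSeq 0 = false := rfl

/-- **The Thue–Morse recursion** `t_{2k} = t_k`. [cite: Lothaire1997, Prop 2.2.2 (proof)] -/
theorem thueMorseSeq_two_mul (k : ℕ) : thueMorseSeq (2 * k) = thueMorseSeq k := by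
  have hk : k < 2 ^ (2 * k) :=
    Nat.lt_two_pow_self.trans_le (Nat.pow_le_pow_right two_pos (by omega))
  have h2k : 2 * k < 2 ^ (2 * k + 1) := by rw [Nat.pow_succ]; omega
  have h := getElem?_thueMorseWord h2k
  rw [thueMorseWord_succ', getElem?_thueMorseMorphism_two_mul, getElem?_thueMorseWord hk] at h
  exact (Option.some.inj h).symm

/-- **The Thue–Morse recursion** `t_{2k+1} = t̄_k`. [cite: Lothaire1997, Prop 2.2.2 (proof)] -/
theorem thueMorseSeq_two_mul_add_one (k : ℕ) : thueMorseSeq (2 * k + 1) = !thueMorseSeq k := by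
  have hk : k < 2 ^ (2 * k) :=
    Nat.lt_two_pow_self.trans_le (Nat.pow_le_pow_right two_pos (by omega))
  have h2k : 2 * k + 1 < 2 ^ (2 * k + 1) := by rw [Nat.pow_succ]; omega
  have h := getElem?_thueMorseWord h2k
  rw [thueMorseWord_succ', getElem?_thueMorseMorphism_two_mul_add_one, getElem?_thueMorseWord hk]
    at h
  exact (Option.some.inj h).symm

/-- **Proposition 2.2.2 (Lothaire 1997)**: `tₙ = a` if `d₂(n) ≡ 0`, `tₙ = b` if `d₂(n) ≡ 1 (mod 2)`,
where `d₂(n)` is the sum of the binary digits of `n`. [cite: Lothaire1997, Prop 2.2.2] -/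
theorem thueMorseSeq_eq_true_iff (n : ℕ) : thueMorseSeq n = true ↔ Odd (Nat.digits 2 n).sum := by
  induction n using Nat.strong_induction_on with
  | _ n ih =>
    rcases Nat.eq_zero_or_pos n with rfl | hn
    · simp
    rcases Nat.even_or_odd n with ⟨m, rfl⟩ | ⟨m, rfl⟩
    · have hm : m < m + m := by omega
      rw [← two_mul, thueMorseSeq_two_mul, Nat.digits_def' one_lt_two (show 0 < 2 * m by omega),
        Nat.mul_mod_right, Nat.mul_div_cancel_left m two_pos, List.sum_cons, zero_add, ih m hm]
    · rw [thueMorseSeq_two_mul_add_one, Nat.digits_def' one_lt_two (show 0 < 2 * m + 1 by omega),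
        List.sum_cons, show (2 * m + 1) % 2 = 1 by omega, show (2 * m + 1) / 2 = m by omega,
        add_comm, Nat.odd_add_one, ← ih m (by omega)]
      cases thueMorseSeq m <;> simp

/-- The left factor `t₀ ⋯ t₁₅ = abbabaabbaababba` of `t`.
[cite: Lothaire1997, §2.2 (t = abbabaabbaababbab⋯)] -/
example : (List.range 16).map thueMorseSeq =
    [false, true, true, false, true, false, false, true,
      true, false, false, true, false, true, true, false] := by
  decide

/-! ### The sign form already in the tree -/

/-- Bridge to the tree's Thue–Morse SIGN cells `ε⁽ⁿ⁾_j = (−1)^{d₂(j)}` of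
`Literature/Combinatorics/Enumerative/ProuhetThueMorse.lean` (`mpSign`; Prouhet's multigrades):
for `j < 2ⁿ`, `ε⁽ⁿ⁾_j = −1` iff `t_j = b`. [cite: Lothaire1997, Prop 2.2.2] -/
theorem mpSign_eq_ite_thueMorseSeq {n j : ℕ} (hj : j < 2 ^ n) :
    Literature.Combinatorics.Enumerative.ProuhetThueMorse.mpSign n j =
      if thueMorseSeq j then -1 else 1 := by
  rw [Literature.Combinatorics.Enumerative.ProuhetThueMorse.mpSign_eq_neg_one_pow_digitSum hj]
  by_cases h : thueMorseSeq j = true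
  · rw [if_pos h, ((thueMorseSeq_eq_true_iff j).1 h).neg_one_pow]
  · rw [if_neg h, (Nat.not_odd_iff_even.1 (mt (thueMorseSeq_eq_true_iff j).2 h)).neg_one_pow]

/-! ### Theorem 2.2.3 for the infinite word -/

/-- **Theorem 2.2.3 (Thue 1906/1912, Morse 1921; Lothaire 1997)**: the infinite word `t` has no
overlapping factor — in window form (Lemma 2.1.1): no factor `tᵢ ⋯ t_{i+2p}` of length `2p + 1`
has the period `p = q + 1 ≥ 1`; some `j ≤ p` has `t_{i+j} ≠ t_{i+j+p}`.  (Every factor of `t`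
occurs in a left factor `uₙ = μⁿ(a)`, which has no overlapping factor by
`not_hasOverlap_thueMorseWord`.) [cite: Lothaire1997, Thm 2.2.3] -/
theorem exists_thueMorseSeq_ne (i q : ℕ) :
    ∃ j ≤ q + 1, thueMorseSeq (i + j) ≠ thueMorseSeq (i + j + (q + 1)) := by
  by_contra h
  push Not at h
  set n := i + (2 * q + 3) with hn
  have hN : i + (2 * q + 3) ≤ 2 ^ n := (Nat.lt_two_pow_self (n := n)).le
  obtain ⟨r, hr⟩ : ∃ r, 2 ^ n = i + (2 * q + 3) + r := ⟨2 ^ n - (i + (2 * q + 3)), by omega⟩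
  have hsplit : List.range' 0 (i + (2 * q + 3) + r) =
      List.range' 0 i ++
        (List.range' (0 + i) (2 * q + 3) ++ List.range' (0 + i + (2 * q + 3)) r) := by
    rw [List.range'_append_1, List.range'_append_1, Nat.add_assoc]
  refine not_hasOverlap_thueMorseWord n (hasOverlap_iff_exists_infix_hasPeriod.2
    ⟨(List.range' i (2 * q + 3)).map thueMorseSeq, q + 1, ?_, Nat.succ_pos q,
      by simp only [List.length_map, List.length_range']; omega, ?_⟩)
  · rw [thueMorseWord_eq_map_range, List.range_eq_range', hr, hsplit, List.map_append,
      List.map_append, Nat.zero_add]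
    exact List.infix_append' _ _ _
  · rw [List.hasPeriod_iff_getElem?]
    intro j hj
    simp only [List.length_map, List.length_range'] at hj
    rw [List.getElem?_map, List.getElem?_map, List.getElem?_range' (by omega),
      List.getElem?_range' (by omega), Option.map_some, Option.map_some, Nat.one_mul, Nat.one_mul,
      ← Nat.add_assoc, h j (by omega)]

/-- The same with `p ≥ 1` explicit: no window `tᵢ ⋯ t_{i+2p}` of `t` has period `p`.
[cite: Lothaire1997, Thm 2.2.3] -/
theorem not_forall_thueMorseSeq_eq_add {p : ℕ} (hp : 0 < p) (i : ℕ) :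
    ¬ ∀ j ≤ p, thueMorseSeq (i + j) = thueMorseSeq (i + j + p) := by
  obtain ⟨q, rfl⟩ : ∃ q, p = q + 1 := ⟨p - 1, by omega⟩
  intro h
  obtain ⟨j, hj, hne⟩ := exists_thueMorseSeq_ne i q
  exact hne (h j hj)

/-- **Corollary 2.2.4 (Lothaire 1997) for `t`**: `t` is cube-free — no factor `u u u`
(`|u| = p ≥ 1`), i.e. no window of length `3p` with period `p`. [cite: Lothaire1997, Cor 2.2.4] -/
theorem not_forall_thueMorseSeq_eq_add_of_cube {p : ℕ} (hp : 0 < p) (i : ℕ) :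
    ¬ ∀ j < 2 * p, thueMorseSeq (i + j) = thueMorseSeq (i + j + p) :=
  fun h => not_forall_thueMorseSeq_eq_add hp i fun j hj => h j (by omega)

/-- In particular `t` has no factor `ccc`: among three consecutive letters two neighbours differ.
[cite: Lothaire1997, Cor 2.2.4 (cube of a letter)] -/
theorem thueMorseSeq_ne_or_ne (i : ℕ) :
    thueMorseSeq i ≠ thueMorseSeq (i + 1) ∨ thueMorseSeq (i + 1) ≠ thueMorseSeq (i + 2) := by
  obtain ⟨j, hj, hne⟩ := exists_thueMorseSeq_ne i 0
  rcases Nat.le_one_iff_eq_zero_or_eq_one.1 (by omega : j ≤ 1) with rfl | rfl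
  · exact Or.inl (by simpa using hne)
  · exact Or.inr (by simpa using hne)

end Literature.Combinatorics.Words
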